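/-
Copyright (c) 2026. All rights reserved.
Released under Apache 2.0 license as described in the file LICENSE.
-/
import Literature.NumberTheory.Automorphic.MaximalOrderDiscThirteenLattice
import HarnessLib

/-!
# Small representation numbers of the norm form `Q₁₃ = a² + 2b² + 4c² + 2d² + ac − ad + 2bc + bd` of the maximal order `O₁₃` of
# `(−2,−13 ∣ ℚ)`: `r₁₃(2) = 6`, `r₁₃(3) = 8`, `r₁₃(4) = 14`, `r₁₃(5) = 12`, `r₁₃(6) = 24`, `r₁₃(8) = 30`, `r₁₃(9) = 26`, `r₁₃(16) = 62`
# — certified box counts, all equal to `2(σ(n) − 13σ(n/13))`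

[tag: quaternion_algebra] [tag: quadratic_form] [tag: brandt_matrix]

Topic `NumberTheory/Automorphic`; THEOREMS ONLY (no definition, no named fact, no instance; net Literature debt `0`).
Lane `lit-hodgefound`, seat p12, gen 46 — a file of the series on the definite quaternion order of discriminant `13`, the `D = 13`
counterpart of `MaximalOrderDiscFiveNormsSmall` ∕ `MaximalOrderDiscSevenNormsSmall`.

`MaximalOrderDiscThirteenLattice` identified `#{x ∈ O₁₃ : nrd x = n}` with the number `r₁₃(n)` of integer solutions of `Q₁₃ = n`
(`natCard_reducedNorm_eq_natCard_form`) and computed `r₁₃(1) = 2`; `MaximalOrderDiscThirteenNormsThirteenMul` gives `r₁₃(13ᵃm) = r₁₃(m)`.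
Eichler's theory predicts, once `# Cls O₁₃ = 1` is known (Voight Exercise 17.10 (a), Thm. 25.4.1; in the tree
`MaximalOrderDiscThirteenClassNumberOne`), that `r₁₃(n) = 2w·T(n) = 2·Σ_{d ∣ n, 13 ∤ d} d = 2σ(n) − 26σ(n/13)` (row sums `σ(n)` of
`B(n)` for `(n, 13) = 1`, LNM 320 II §6 Cor. 1; `B(13ᵃ) = 1`; `w = 1`); equivalently the theta series of `O₁₃` is the Eisenstein
series of weight `2` and level `13` (`M₂(Γ₀(13))` is one-dimensional). This file CERTIFIES the first values by enumeration —
independently of the class number — after confining the solutions of `Q₁₃ = n` to a box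
(`16Q₁₃ = 4(2a+c−d)² + 2(4b+2c+d)² + 52c² + 26d²`, so `a² ≤ 3n`, `b² ≤ 2n`, `c², d² ≤ n`):

* §1 `sixteen_mul_form_eq` (the sum-of-squares identity), `sq_le_of_form_eq` (`a² ≤ 3n ∧ b² ≤ 2n ∧ c² ≤ n ∧ d² ≤ n`),
  **`natCard_form_eq_card_filter_box`** (the count is the box count over `[−B₁,B₁]×[−B₂,B₂]×[−B₃,B₃]×[−B₄,B₄]` whenever
  `3n < (B₁+1)²`, `2n < (B₂+1)²`, `n < (B₃+1)²`, `n < (B₄+1)²`);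
* §2 **`natCard_form_two`** (`6 = 2·3`), **`natCard_form_three`** (`8 = 2·4`), **`natCard_form_four`** (`14 = 2·7`),
  **`natCard_form_five`** (`12 = 2·6`), **`natCard_form_six`** (`24 = 2·12`), **`natCard_form_eight`** (`30 = 2·15`),
  **`natCard_form_nine`** (`26 = 2·13`), **`natCard_form_sixteen`** (`62 = 2·31`) — by `decide +kernel` on boxes of at most
  `13·11·9·9` points (the divisor sums `σ = 3, 4, 7, 6, 12, 15, 13, 31` are
  `MaximalOrderDiscSevenNormsSmall.sigma_values`), and for `O₁₃`: `natCard_reducedNorm_two`, `_three`, `_four`.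

## Sources

* M. Eichler, LNM 320 (1973), Ch. II §6 Thm. 2 (18)–(19) and Cor. 1 (row sums `σ(n)` of the Brandt matrices for `(n, D) = 1`;
  the recursion at split primes), §2. [cite: Eichler1973, Ch. II §6 Thm. 2 (18)–(19) and Cor. 1]
* J. Voight, *Quaternion Algebras*, GTM 288 (2021), Exercise 17.10 ((a) `# Cls O = 1` for discriminant `13`; (b) the quaternary
  form `t² + ty + tz + 2x² + xy + 2xz + 2y² + yz + 4z²` is multiplicative and universal), Thm. 25.1.1 (mass `1`), Thm. 25.4.1.
  [cite: Voight2021, Exercise 17.10; Thm. 25.4.1]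

## Scope (honest)

Theorems only. Eight individual values by certified enumeration; the closed formula `r₁₃(n) = 2σ(n) − 26σ(n/13)` for all `n`
needs `# Cls O₁₃ = 1` together with the Hecke theory of the Brandt matrices at the split primes, which is not invoked here.
-/

open Quaternion
open Finset

namespace Literature.NumberTheory.Automorphic.MaxOrderDiscThirteen

/-! ## §1 The solutions of `Q₁₃ = n` lie in a box -/

section Box

/-- `16·Q₁₃(a,b,c,d) = 4(2a + c − d)² + 2(4b + 2c + d)² + 52c² + 26d²`. [cite: Voight2021, Exercise 17.10 (b)] -/
theorem sixteen_mul_form_eq (a b c d : ℤ) :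
    16 * (a ^ 2 + 2 * b ^ 2 + 4 * c ^ 2 + 2 * d ^ 2 + a * c - a * d + 2 * b * c + b * d) =
      4 * (2 * a + c - d) ^ 2 + 2 * (4 * b + 2 * c + d) ^ 2 + 52 * c ^ 2 + 26 * d ^ 2 := by
  ring

/-- `Q₁₃(a,b,c,d) = n ⟹ a² ≤ 3n ∧ b² ≤ 2n ∧ c² ≤ n ∧ d² ≤ n`. [cite: Voight2021, Exercise 17.10 (b)] -/
theorem sq_le_of_form_eq {a b c d n : ℤ} (h : a ^ 2 + 2 * b ^ 2 + 4 * c ^ 2 + 2 * d ^ 2 + a * c - a * d + 2 * b * c + b * d = n) :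
    a ^ 2 ≤ 3 * n ∧ b ^ 2 ≤ 2 * n ∧ c ^ 2 ≤ n ∧ d ^ 2 ≤ n := by
  have h16 := sixteen_mul_form_eq a b c d
  rw [h] at h16
  have hc : c ^ 2 ≤ n := by nlinarith [sq_nonneg (2 * a + c - d), sq_nonneg (4 * b + 2 * c + d), sq_nonneg d, sq_nonneg c]
  have hd : d ^ 2 ≤ n := by nlinarith [sq_nonneg (2 * a + c - d), sq_nonneg (4 * b + 2 * c + d), sq_nonneg c, sq_nonneg d]
  refine ⟨?_, ?_, hc, hd⟩
  · nlinarith [sq_nonneg (2 * a + c - d + c), sq_nonneg (2 * a + c - d - d), sq_nonneg (c + d), sq_nonneg (4 * b + 2 * c + d),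
      sq_nonneg c, sq_nonneg d]
  · nlinarith [sq_nonneg (4 * b + 2 * c + d + 2 * c), sq_nonneg (4 * b + 2 * c + d + d), sq_nonneg (2 * c - d),
      sq_nonneg (2 * a + c - d), sq_nonneg c, sq_nonneg d]

/-- `x² ≤ m`, `m < (B+1)²`, `0 ≤ B` ⟹ `−B ≤ x ≤ B`. [folklore] -/
private theorem abs_le_of_sq_le {x m B : ℤ} (hB : 0 ≤ B) (hx : x ^ 2 ≤ m) (hm : m < (B + 1) ^ 2) : -B ≤ x ∧ x ≤ B := by
  have h : x ^ 2 < (B + 1) ^ 2 := lt_of_le_of_lt hx hm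
  have habs : |x| < B + 1 := abs_lt_of_sq_lt_sq h (by linarith)
  obtain ⟨h1, h2⟩ := abs_lt.1 habs
  constructor <;> omega

/-- **The representation count is a finite box count:** if `3n < (B₁+1)²`, `2n < (B₂+1)²`, `n < (B₃+1)²`, `n < (B₄+1)²` then the
solutions of `Q₁₃ = n` are exactly those in the box `[−B₁,B₁] × [−B₂,B₂] × [−B₃,B₃] × [−B₄,B₄]`. [cite: Voight2021, Exercise 17.10 (b)] -/
theorem natCard_form_eq_card_filter_box (n B₁ B₂ B₃ B₄ : ℤ) (hB₁ : 0 ≤ B₁) (hB₂ : 0 ≤ B₂) (hB₃ : 0 ≤ B₃) (hB₄ : 0 ≤ B₄)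
    (h₁ : 3 * n < (B₁ + 1) ^ 2) (h₂ : 2 * n < (B₂ + 1) ^ 2) (h₃ : n < (B₃ + 1) ^ 2) (h₄ : n < (B₄ + 1) ^ 2) :
    Nat.card {v : ℤ × ℤ × ℤ × ℤ //
        v.1 ^ 2 + 2 * v.2.1 ^ 2 + 4 * v.2.2.1 ^ 2 + 2 * v.2.2.2 ^ 2 + v.1 * v.2.2.1 - v.1 * v.2.2.2 +
          2 * v.2.1 * v.2.2.1 + v.2.1 * v.2.2.2 = n} =
      ((Icc (-B₁) B₁ ×ˢ Icc (-B₂) B₂ ×ˢ Icc (-B₃) B₃ ×ˢ Icc (-B₄) B₄).filter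
        fun v : ℤ × ℤ × ℤ × ℤ => v.1 ^ 2 + 2 * v.2.1 ^ 2 + 4 * v.2.2.1 ^ 2 + 2 * v.2.2.2 ^ 2 + v.1 * v.2.2.1 - v.1 * v.2.2.2 + 2 * v.2.1 * v.2.2.1 + v.2.1 * v.2.2.2 = n).card := by
  have hS : {v : ℤ × ℤ × ℤ × ℤ |
      v.1 ^ 2 + 2 * v.2.1 ^ 2 + 4 * v.2.2.1 ^ 2 + 2 * v.2.2.2 ^ 2 + v.1 * v.2.2.1 - v.1 * v.2.2.2 +
          2 * v.2.1 * v.2.2.1 + v.2.1 * v.2.2.2 = n} =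
      ↑((Icc (-B₁) B₁ ×ˢ Icc (-B₂) B₂ ×ˢ Icc (-B₃) B₃ ×ˢ Icc (-B₄) B₄).filter
        fun v : ℤ × ℤ × ℤ × ℤ => v.1 ^ 2 + 2 * v.2.1 ^ 2 + 4 * v.2.2.1 ^ 2 + 2 * v.2.2.2 ^ 2 + v.1 * v.2.2.1 - v.1 * v.2.2.2 + 2 * v.2.1 * v.2.2.1 + v.2.1 * v.2.2.2 = n) := by
    ext ⟨a, b, c, d⟩
    simp only [Set.mem_setOf_eq, coe_filter, mem_Icc, mem_product]
    constructor
    · intro h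
      obtain ⟨ha, hb, hc, hd⟩ := sq_le_of_form_eq h
      exact ⟨⟨abs_le_of_sq_le hB₁ ha h₁, abs_le_of_sq_le hB₂ hb h₂, abs_le_of_sq_le hB₃ hc h₃, abs_le_of_sq_le hB₄ hd h₄⟩, h⟩
    · exact And.right
  rw [← Set.ncard_coe_finset, ← hS]
  exact Nat.card_coe_set_eq _

end Box

/-! ## §2 `r₁₃(2) = 6`, `r₁₃(3) = 8`, `r₁₃(4) = 14`, `r₁₃(5) = 12`, `r₁₃(6) = 24`, `r₁₃(8) = 30`, `r₁₃(9) = 26`, `r₁₃(16) = 62` -/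

section Counts

/-- **`r₁₃(2) = 6 = 2σ(2)`**. [cite: Eichler1973, Ch. II §6 Thm. 2 Cor. 1] [cite: Voight2021, Exercise 17.10] -/
theorem natCard_form_two :
    Nat.card {v : ℤ × ℤ × ℤ × ℤ //
        v.1 ^ 2 + 2 * v.2.1 ^ 2 + 4 * v.2.2.1 ^ 2 + 2 * v.2.2.2 ^ 2 + v.1 * v.2.2.1 - v.1 * v.2.2.2 +
          2 * v.2.1 * v.2.2.1 + v.2.1 * v.2.2.2 = 2} = 6 := by
  rw [natCard_form_eq_card_filter_box 2 2 2 1 1 (by norm_num) (by norm_num) (by norm_num) (by norm_num) (by norm_num) (by norm_num)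
    (by norm_num) (by norm_num)]
  decide +kernel

/-- **`r₁₃(3) = 8 = 2σ(3)`**. [cite: Eichler1973, Ch. II §6 Thm. 2 Cor. 1] [cite: Voight2021, Exercise 17.10] -/
theorem natCard_form_three :
    Nat.card {v : ℤ × ℤ × ℤ × ℤ //
        v.1 ^ 2 + 2 * v.2.1 ^ 2 + 4 * v.2.2.1 ^ 2 + 2 * v.2.2.2 ^ 2 + v.1 * v.2.2.1 - v.1 * v.2.2.2 +
          2 * v.2.1 * v.2.2.1 + v.2.1 * v.2.2.2 = 3} = 8 := by
  rw [natCard_form_eq_card_filter_box 3 3 2 1 1 (by norm_num) (by norm_num) (by norm_num) (by norm_num) (by norm_num) (by norm_num)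
    (by norm_num) (by norm_num)]
  decide +kernel

/-- **`r₁₃(4) = 14 = 2σ(4)`** (a non-squarefree value: `T(4) = 7 = T(2)² − 2`, Eichler's recursion at the split prime `2`). [cite: Eichler1973, Ch. II §6 Thm. 2 (19) and Cor. 1] -/
theorem natCard_form_four :
    Nat.card {v : ℤ × ℤ × ℤ × ℤ //
        v.1 ^ 2 + 2 * v.2.1 ^ 2 + 4 * v.2.2.1 ^ 2 + 2 * v.2.2.2 ^ 2 + v.1 * v.2.2.1 - v.1 * v.2.2.2 +
          2 * v.2.1 * v.2.2.1 + v.2.1 * v.2.2.2 = 4} = 14 := by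
  rw [natCard_form_eq_card_filter_box 4 3 2 2 2 (by norm_num) (by norm_num) (by norm_num) (by norm_num) (by norm_num) (by norm_num)
    (by norm_num) (by norm_num)]
  decide +kernel

/-- **`r₁₃(5) = 12 = 2σ(5)`**. [cite: Eichler1973, Ch. II §6 Thm. 2 Cor. 1] [cite: Voight2021, Exercise 17.10] -/
theorem natCard_form_five :
    Nat.card {v : ℤ × ℤ × ℤ × ℤ //
        v.1 ^ 2 + 2 * v.2.1 ^ 2 + 4 * v.2.2.1 ^ 2 + 2 * v.2.2.2 ^ 2 + v.1 * v.2.2.1 - v.1 * v.2.2.2 +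
          2 * v.2.1 * v.2.2.1 + v.2.1 * v.2.2.2 = 5} = 12 := by
  rw [natCard_form_eq_card_filter_box 5 3 3 2 2 (by norm_num) (by norm_num) (by norm_num) (by norm_num) (by norm_num) (by norm_num)
    (by norm_num) (by norm_num)]
  decide +kernel

/-- **`r₁₃(6) = 24 = 2σ(6)`** (`= r₁₃(2)r₁₃(3)/2`: multiplicativity). [cite: Eichler1973, Ch. II §6 Thm. 2 (18) and Cor. 1] -/
theorem natCard_form_six :
    Nat.card {v : ℤ × ℤ × ℤ × ℤ //
        v.1 ^ 2 + 2 * v.2.1 ^ 2 + 4 * v.2.2.1 ^ 2 + 2 * v.2.2.2 ^ 2 + v.1 * v.2.2.1 - v.1 * v.2.2.2 +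
          2 * v.2.1 * v.2.2.1 + v.2.1 * v.2.2.2 = 6} = 24 := by
  rw [natCard_form_eq_card_filter_box 6 4 3 2 2 (by norm_num) (by norm_num) (by norm_num) (by norm_num) (by norm_num) (by norm_num)
    (by norm_num) (by norm_num)]
  decide +kernel

/-- **`r₁₃(8) = 30 = 2σ(8)`** (`T(8) = 15 = T(2)T(4) − 2T(2)`). [cite: Eichler1973, Ch. II §6 Thm. 2 (19) and Cor. 1] -/
theorem natCard_form_eight :
    Nat.card {v : ℤ × ℤ × ℤ × ℤ //
        v.1 ^ 2 + 2 * v.2.1 ^ 2 + 4 * v.2.2.1 ^ 2 + 2 * v.2.2.2 ^ 2 + v.1 * v.2.2.1 - v.1 * v.2.2.2 +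
          2 * v.2.1 * v.2.2.1 + v.2.1 * v.2.2.2 = 8} = 30 := by
  rw [natCard_form_eq_card_filter_box 8 4 4 2 2 (by norm_num) (by norm_num) (by norm_num) (by norm_num) (by norm_num) (by norm_num)
    (by norm_num) (by norm_num)]
  decide +kernel

/-- **`r₁₃(9) = 26 = 2σ(9)`** (`T(9) = 13 = T(3)² − 3`, Eichler's recursion at the split prime `3`). [cite: Eichler1973, Ch. II §6 Thm. 2 (19) and Cor. 1] -/
theorem natCard_form_nine :
    Nat.card {v : ℤ × ℤ × ℤ × ℤ //
        v.1 ^ 2 + 2 * v.2.1 ^ 2 + 4 * v.2.2.1 ^ 2 + 2 * v.2.2.2 ^ 2 + v.1 * v.2.2.1 - v.1 * v.2.2.2 +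
          2 * v.2.1 * v.2.2.1 + v.2.1 * v.2.2.2 = 9} = 26 := by
  rw [natCard_form_eq_card_filter_box 9 5 4 3 3 (by norm_num) (by norm_num) (by norm_num) (by norm_num) (by norm_num) (by norm_num)
    (by norm_num) (by norm_num)]
  decide +kernel

/-- **`r₁₃(16) = 62 = 2σ(16)`** (`T(16) = 31 = T(2)T(8) − 2T(4)`). [cite: Eichler1973, Ch. II §6 Thm. 2 (19) and Cor. 1] -/
theorem natCard_form_sixteen :
    Nat.card {v : ℤ × ℤ × ℤ × ℤ //
        v.1 ^ 2 + 2 * v.2.1 ^ 2 + 4 * v.2.2.1 ^ 2 + 2 * v.2.2.2 ^ 2 + v.1 * v.2.2.1 - v.1 * v.2.2.2 +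
          2 * v.2.1 * v.2.2.1 + v.2.1 * v.2.2.2 = 16} = 62 := by
  rw [natCard_form_eq_card_filter_box 16 6 5 4 4 (by norm_num) (by norm_num) (by norm_num) (by norm_num) (by norm_num) (by norm_num)
    (by norm_num) (by norm_num)]
  decide +kernel

/-- **`#{x ∈ O₁₃ : nrd x = 2} = 6`.** [cite: Eichler1973, Ch. II §6 Thm. 2 Cor. 1] [cite: Voight2021, Exercise 17.10] -/
theorem natCard_reducedNorm_two : Nat.card {x : ℍ[ℚ,-2,-13] // x ∈ (Submodule.span ℤ (Set.range ![(⟨1, 0, 0, 0⟩ : ℍ[ℚ,-2,-13]), ⟨0, 1, 0, 0⟩, ⟨1/2, 1/2, 1/2, 0⟩, ⟨-1/2, 1/4, 0, 1/4⟩])) ∧ reducedNorm ℚ ℍ[ℚ,-2,-13] x = (2 : ℕ)} = 6 := by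
  have h := natCard_reducedNorm_eq_natCard_form ((2 : ℕ) : ℤ)
  push_cast at h ⊢
  rw [h]
  exact natCard_form_two

/-- **`#{x ∈ O₁₃ : nrd x = 3} = 8`.** [cite: Eichler1973, Ch. II §6 Thm. 2 Cor. 1] [cite: Voight2021, Exercise 17.10] -/
theorem natCard_reducedNorm_three : Nat.card {x : ℍ[ℚ,-2,-13] // x ∈ (Submodule.span ℤ (Set.range ![(⟨1, 0, 0, 0⟩ : ℍ[ℚ,-2,-13]), ⟨0, 1, 0, 0⟩, ⟨1/2, 1/2, 1/2, 0⟩, ⟨-1/2, 1/4, 0, 1/4⟩])) ∧ reducedNorm ℚ ℍ[ℚ,-2,-13] x = (3 : ℕ)} = 8 := by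
  have h := natCard_reducedNorm_eq_natCard_form ((3 : ℕ) : ℤ)
  push_cast at h ⊢
  rw [h]
  exact natCard_form_three

/-- **`#{x ∈ O₁₃ : nrd x = 4} = 14`.** [cite: Eichler1973, Ch. II §6 Thm. 2 (19) and Cor. 1] -/
theorem natCard_reducedNorm_four : Nat.card {x : ℍ[ℚ,-2,-13] // x ∈ (Submodule.span ℤ (Set.range ![(⟨1, 0, 0, 0⟩ : ℍ[ℚ,-2,-13]), ⟨0, 1, 0, 0⟩, ⟨1/2, 1/2, 1/2, 0⟩, ⟨-1/2, 1/4, 0, 1/4⟩])) ∧ reducedNorm ℚ ℍ[ℚ,-2,-13] x = (4 : ℕ)} = 14 := by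
  have h := natCard_reducedNorm_eq_natCard_form ((4 : ℕ) : ℤ)
  push_cast at h ⊢
  rw [h]
  exact natCard_form_four

end Counts

end Literature.NumberTheory.Automorphic.MaxOrderDiscThirteen
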